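import Literature.NumberTheory.PAdicHodge.AinfWeierstrassRamifiedTorsionWitness
import HarnessLib

/-!
# A Tate-module point of the `𝒪_F`-model with `‖p‖ ≤ ‖τ₁‖^{p²−1}` (the `≤ p²−1`-form of the ramified torsion witness; proofs only)

Topic `Literature/NumberTheory/PAdicHodge`; namespace `Literature.NumberTheory.PAdicHodge.AinfTop`. THEOREMS ONLY (no definition, no named fact, no instance,
no `sorry`). For the good `𝒪_F`-model `W` (coefficients `LTCoeff F`, ANY ramification of `F`) with supersingular reduction of exact height `2` at the odd residue
characteristic `p`: **`exists_tatePtO_norm_p_le_norm_pow`** — some `τ ∈ T_pŴ(𝒪_{ℂ_F})` has `τ₁ ≠ 0` and `‖p‖ ≤ ‖τ₁‖^{p²−1}`. Same proof as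
`AinfWeierstrassRamifiedTorsionWitness.exists_tatePtO_norm_p_lt_norm_pow` (lift of a `p`-torsion point of `E(F̄)` along `T_pE(F̄) → T_pE(ℂ_F) ≅ T_pŴ(𝒪_{ℂ_F})`),
fed with `exists_norm_p_le_norm_pow_of_roots` (the product of the `p² − 1` non-zero torsion parameters has norm `‖p‖`) instead of its `‖p‖ < ‖s‖^p` corollary.

Purpose (crux K★ `stmt-BirchSwinnertonDyer-22226`, line `kato_lever`, memo `Lines/kato-lever-K2-ramified-cm-transport.md` §10.1): for a ramified good model `W_D`
(`‖ϖ‖^e = ‖p‖`, `e < p² − 1`) this `τ` has `‖τ₁‖ > ‖ϖ‖`, so its CM-fibre transport `Tτ` has `(Tτ)₁ ≠ 0` — the entry point of the non-degeneracy dichotomy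
`AinfRamifiedTransportedPeriodNondegenerate`. Infrastructure only; BSD / K★ are not proved by any of this.

## References
* J.-P. Serre, *Propriétés galoisiennes des points d'ordre fini des courbes elliptiques*, Invent. Math. 15 (1972), §1.11. [Serre1972]
* J. H. Silverman, *The Arithmetic of Elliptic Curves* (2009), III.§7, IV.7.5, VII.2.2. [SilvermanAEC2009]
-/

noncomputable section

open scoped Classical NNReal
open Field ValuativeRel Polynomial

namespace Literature.NumberTheory.PAdicHodge

namespace AinfTop

open Literature.NumberTheory.GaloisRepresentations
open Literature.NumberTheory.GaloisRepresentations.IsNonarchimedeanLocalField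
open Literature.NumberTheory.GaloisRepresentations.LubinTate
open Literature.NumberTheory.EllipticCurves Literature.NumberTheory.EllipticCurves.FormalGroupChart

variable {F : Type} [Field F] [ValuativeRel F] [TopologicalSpace F] [IsNonarchimedeanLocalField F]
  {p : ℕ} [Fact p.Prime] (W : WeierstrassCurve (LTCoeff F)) [CharZero F] [CharP 𝓀[F] p]

/-- **A Tate-module point `τ ∈ T_pŴ(𝒪_{ℂ_F})` with `τ₁ ≠ 0` and `‖p‖ ≤ ‖τ₁‖^{p²−1}`** for the good `𝒪_F`-model `W` (`Δ ∈ 𝒪_Fˣ`) with supersingular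
reduction of exact height `2` at the odd residue characteristic `p` (the product of the `p² − 1` non-zero `p`-torsion parameters has norm `‖p‖`, so one of them
has `‖s‖^{p²−1} ≥ ‖p‖`; lifted along `T_pE(F̄) → T_pE(ℂ_F) ≅ T_pŴ(𝒪_{ℂ_F})` exactly as in `exists_tatePtO_norm_p_lt_norm_pow`). [cite: Serre1972, §1.11]
[cite: SilvermanAEC2009, Prop. VII.2.2] -/
theorem exists_tatePtO_norm_p_le_norm_pow (hp2 : p ≠ 2) (hΔ : IsUnit W.Δ) (hA : (W.map (redCoeff F)).hasseCoeff p = 0)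
    (hht : PowerSeries.coeff (p ^ 2) ((W.map (redCoeff F)).formalMul p) ≠ 0) :
    ∃ τ : TatePtO F W p, ((((TateModule.proj p 1 τ).val : (maxNilIdealC F).toIdeal) : CBall F) : CompletedAlgClosure F) ≠ 0 ∧
      ‖(p : CompletedAlgClosure F)‖ ≤
        ‖((((TateModule.proj p 1 τ).val : (maxNilIdealC F).toIdeal) : CBall F) : CompletedAlgClosure F)‖ ^ (p ^ 2 - 1) := by
  have hp : p.Prime := Fact.out
  haveI hEC : (curveOver (CompletedAlgClosure F) W).IsElliptic := isElliptic_curveOverC_O (F := F) hΔ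
  set EF : WeierstrassCurve F := W.map (algebraMap (LTCoeff F) F) with hEF
  haveI : EF.IsElliptic := ⟨by rw [hEF, WeierstrassCurve.map_Δ]; exact hΔ.map _⟩
  set Eb : WeierstrassCurve (AlgebraicClosure F) := EF.baseChange (AlgebraicClosure F) with hEb
  haveI : CharZero (AlgebraicClosure F) :=
    charZero_of_injective_algebraMap (algebraMap F (AlgebraicClosure F)).injective
  have hpK : ((p : ℕ) : AlgebraicClosure F) ≠ 0 := Nat.cast_ne_zero.mpr hp.ne_zero
  -- the `p`-torsion of `E(F̄)` and its image in `E₁(ℂ_F)`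
  set T := AddSubgroup.torsionBy Eb.toAffine.Point (p : ℤ) with hT
  have hcard : Nat.card T = p ^ 2 := WeierstrassCurve.card_torsionBy_eq_sq (E := Eb) hpK
  haveI : Finite T := Nat.finite_of_card_ne_zero (by rw [hcard]; exact pow_ne_zero _ hp.ne_zero)
  haveI : Fintype T := Fintype.ofFinite T
  have hbar := baseChange_map_algClosureToC_eq_curveOver W
  set ψ : Eb.toAffine.Point →+ (curveOver (CompletedAlgClosure F) W).toAffine.Point :=
    (WeierstrassCurve.Affine.Point.congrEquiv hbar).toAddMonoidHom.comp (Eb.mapPointHom (algClosureToC F)) with hψ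
  have hψinj : Function.Injective ψ :=
    (WeierstrassCurve.Affine.Point.congrEquiv hbar).injective.comp (WeierstrassCurve.mapPointHom_injective _ _)
  have hss := mem_kernel_of_pow_prime_smul_eq_zero_ssO (F := F) (W := W) hp2 hΔ hA
  have hker : ∀ P : T, ψ P.1 ∈ kernel (NormedField.valuation (K := CompletedAlgClosure F)) (curveOver (CompletedAlgClosure F) W) :=
    fun P => hss 1 (ψ P.1) (by rw [pow_one, ← map_nsmul, AddSubgroup.torsionBy.nsmul_iff.mp P.2, map_zero])
  set φ : T → CompletedAlgClosure F := fun P => (ψ P.1).zCoord with hφ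
  have hφinj : Function.Injective φ := by
    intro P Q hPQ
    have h1 : kernelEquivPt (CompletedAlgClosure F) W ⟨ψ P.1, hker P⟩ = kernelEquivPt (CompletedAlgClosure F) W ⟨ψ Q.1, hker Q⟩ := by
      apply WeierstrassCurve.Pt.ext
      rw [kernelEquivPt_apply_val, kernelEquivPt_apply_val]
      exact Subtype.ext (Subtype.ext hPQ)
    have h2 := congrArg Subtype.val ((kernelEquivPt (CompletedAlgClosure F) W).injective h1)
    exact Subtype.ext (hψinj h2)
  -- the finset of `z`-coordinates and a good root
  set S : Finset (CompletedAlgClosure F) := Finset.univ.image φ with hS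
  have hS0 : (0 : CompletedAlgClosure F) ∈ S := by
    refine Finset.mem_image.mpr ⟨⟨0, (AddSubgroup.torsionBy Eb.toAffine.Point (p : ℤ)).zero_mem⟩, Finset.mem_univ _, ?_⟩
    simp only [hφ, map_zero, WeierstrassCurve.Affine.Point.zCoord_zero]
  have hScard : S.card = p ^ 2 := by
    rw [hS, Finset.card_image_of_injective _ hφinj, Finset.card_univ, ← Nat.card_eq_fintype_card, hcard]
  have hSroots : ∀ s ∈ S, ∃ u : (maxNilIdealC F).toIdeal, ((u : CBall F) : CompletedAlgClosure F) = s ∧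
      (evalPt₁ (maxNilIdealC F) (W.formalMul p) (W.constantCoeff_formalMul p) u : CBall F) = 0 := by
    intro s hs
    obtain ⟨P, -, rfl⟩ := Finset.mem_image.mp hs
    refine ⟨zPt (ψ P.1) (hker P), rfl, ?_⟩
    have hnsmul : p • (⟨ψ P.1, hker P⟩ : kernel (NormedField.valuation (K := CompletedAlgClosure F))
        (curveOver (CompletedAlgClosure F) W)) = 0 := by
      apply Subtype.ext
      rw [AddSubmonoidClass.coe_nsmul, ZeroMemClass.coe_zero, ← map_nsmul, AddSubgroup.torsionBy.nsmul_iff.mp P.2, map_zero]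
    have h := congrArg WeierstrassCurve.Pt.val (congrArg (kernelEquivPt (CompletedAlgClosure F) W) hnsmul)
    rw [map_nsmul, map_zero, WeierstrassCurve.Pt.val_nsmul, kernelEquivPt_apply_val, WeierstrassCurve.Pt.val_zero] at h
    exact congrArg Subtype.val h
  obtain ⟨s, hs, hlt⟩ := exists_norm_p_le_norm_pow_of_roots W hp2 hA hht S hS0 hScard hSroots
  obtain ⟨hs0, hsS⟩ := Finset.mem_erase.mp hs
  obtain ⟨P, -, hPs⟩ := Finset.mem_image.mp hsS
  -- lift `P` to `T_pE(F̄)` and transport to `T_pŴ(𝒪_{ℂ_F})`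
  have hP1 : (P.1 : EF.geomPoints) ∈ EF.geomTorsion ((p ^ 1 : ℕ) : ℤ) := by rw [pow_one]; exact P.2
  obtain ⟨a, ha⟩ := WeierstrassCurve.proj_surjective_of_isAlgClosed_holds EF p 1 hP1
  set aC : TateModule (curveOver (CompletedAlgClosure F) W).toAffine.Point p :=
    TateModule.mapEquiv p (WeierstrassCurve.Affine.Point.congrEquiv hbar)
      (tateModuleMapEquiv (algClosureToC F) Eb p hpK a) with haC
  have hproj : TateModule.proj p 1 aC = ψ P.1 := by
    rw [haC, TateModule.proj_mapEquiv, proj_tateModuleMapEquiv]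
    change ψ (TateModule.proj p 1 a) = ψ P.1
    exact congrArg ψ ha
  refine ⟨tateModuleCEquivTatePtOSS F W p hp2 hΔ hA aC, ?_, ?_⟩
  all_goals
    have hval : ((((TateModule.proj p 1 (tateModuleCEquivTatePtOSS F W p hp2 hΔ hA aC)).val : (maxNilIdealC F).toIdeal) :
        CBall F) : CompletedAlgClosure F) = (ψ P.1).zCoord := by
      change ((((TateModule.proj p 1 (tateModuleToPt W p hss aC)).val : (maxNilIdealC F).toIdeal) : CBall F) :
        CompletedAlgClosure F) = _
      rw [coe_proj_tateModuleToPt, hproj]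
    rw [hval]
  · have h := hs0
    rw [← hPs] at h
    exact h
  · have h := hlt
    rw [← hPs] at h
    exact h

end AinfTop

end Literature.NumberTheory.PAdicHodge

end
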